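import Summits.BirchSwinnertonDyer.BirchSwinnertonDyer.Theorems.ManinLocalTwoThreeParabolicHeckeValue
import Summits.BirchSwinnertonDyer.BirchSwinnertonDyer.Theorems.ManinLocalTwoThreeCuspFunSharpEisenstein
import Summits.BirchSwinnertonDyer.BirchSwinnertonDyer.Theorems.ManinLocalTwoThreeParabolicElements
import HarnessLib

/-!
# N4 PARABOLICITY: a non-Eisenstein generalised Hecke eigen-homomorphism of `Γ₀(L)` kills every cusp-fixing element

Summit `BirchSwinnertonDyer`, route `ManinLocalTwoThree` (cell bsd-f2-manin), cruxes C2 `ManinOddAtFour`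
(stmt-BirchSwinnertonDyer-22967, deciding) / C3 `ManinPrimeToThreeAtNine` (stmt-BirchSwinnertonDyer-22968).  The relative
Ihara statement `Summit.BirchSwinnertonDyer.Rank1Residual.ManinAdditive.RelativeIharaShiftVanishingBar` (behind both
generation stubs) is proved by lifting the homomorphism `u` to a `Γ₀(L)`-invariant cusp symbol (E-es-29a (i),
`exists_cuspSymbol_of_parabolic_hom`), which requires `u` to be PARABOLIC: `u(γ) = 0` for every `γ ∈ Γ₀(L)` fixing a point
of `P¹(ℚ)`.  This is step (0) of MEMO-es §22.2, the one input of the Ihara-free route not on §23.4's list (REF1 §R43 «N4»,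
line prover p3 2026-08-28T03:17:26Z (C)); this file proves it:

**`parabolic_of_isHeckeGenEigenvector`.**  `L ≥ 1`, `K` an algebraically closed field, `S ⊇` primes of `L`, `λ : ℕ → K` not a
weight-`2` Eisenstein system, `u ∈ Z¹(Γ₀(L), K) = Hom(Γ₀(L), K)` a generalised eigenvector of every `T_r` (`heckeUZ 0 L K`,
`r ∉ S`) with eigenvalues `λ(r)` (`IsHeckeGenEigenvector S λ u`).  Then `u(γ) = 0` for every `γ ∈ Γ₀(L)` and every cusp `c`
with `γ c = c`.

Proof.  (1) `γ = ± g_c T^w g_c⁻¹` (`exists_eq_parabolicAt_of_smul_eq`).  (2) `u(−1) = 0`: every Hecke coset is fixed by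
`−1`, so `(T_r u)(−1) = (r+1) u(−1)`, and `u(−1) ≠ 0` would force `λ(r) = r + 1` for all `r ∉ S` — Eisenstein with trivial
characters.  (3) For `w ≠ 0`, the cusp function `a = parabolicValue L K w u : x ↦ u(g_x T^w g_x⁻¹)` is `Γ₀(L)`-invariant and,
for primes `r ∤ wL` outside `S`, `parabolicValue w (T_r u) = T♯_r a` with `T♯_r = r ρ_r + ρ_r⁻¹`
(`Theorems/ManinLocalTwoThreeParabolicHeckeValue.lean`); hence `a` is a generalised `λ`-eigenfunction of the `T♯_r`, so
`a = 0` by the transposed Eisenstein analysis (`sharpEisenstein_cuspFun`,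
`Theorems/ManinLocalTwoThreeCuspFunSharpEisenstein.lean`); in particular `u(g_c T^w g_c⁻¹) = 0`.

No new definitions; nothing about BSD or Manin's conjecture is proved here.

References: G. Shimura (1971) §8.1 ((8.1.4) parabolic cocycles), §8.3 (8.3.2); G. Stevens, *Arithmetic on modular curves*
(1982), Thm. 1.3.5; F. Diamond, J. Shurman, GTM 228, Prop. 5.2.3 [cite: DiamondShurman2005, Prop. 5.2.3 (p. 173)]; cell memo
HOME/MEMO-es.md §22.2 (0), §23; REF1 §R43 N4.
-/

set_option autoImplicit false
set_option linter.dupNamespace false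

open scoped MatrixGroups

open CongruenceSubgroup Matrix.SpecialLinearGroup Literature.NumberTheory.EllipticCurves.ModularForms
  Literature.NumberTheory.EllipticCurves.ModularForms.HidaCohomology

namespace Summit.BirchSwinnertonDyer.BirchSwinnertonDyer.Theorems.ManinLocalTwoThree

/-! ### The element `−1` -/

section NegOne

variable (L : ℕ) {K : Type*} [CommRing K] {r : ℕ} [NeZero r] (hr : r.Prime)

-- `neg_one_mem_Gamma0 : (-1 : SL(2, ℤ)) ∈ Gamma0 L` is the lead's (`Theorems/ManinLocalTwoThreeParabolicElements.lean`).

/-- The number of Hecke indices at a level prime to `r` is `r + 1`. [cite: DiamondShurman2005, Prop. 5.2.1] -/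
theorem card_heckeIdx_of_not_dvd (hrL : ¬ r ∣ L) : Fintype.card (HeckeIdx L r) = r + 1 := by
  rw [Fintype.card_congr (Equiv.subtypeUnivEquiv (fun (o : Option (ZMod r)) (_ : o = none) ↦ hrL)),
    Fintype.card_option, ZMod.card]

omit [NeZero r] in
/-- **Every Hecke coset is fixed by `−1`**: `σ_{−1}(i) = i`, `(−1)'ᵢ = −1`. [cite: Shimura1971, §8.3 p. 237] -/
theorem heckePermElt_neg_one (i : HeckeIdx L r) :
    ((heckePermElt hr ⟨-1, neg_one_mem_Gamma0 L⟩ i : Gamma0 L) : SL(2, ℤ)) = -1 := by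
  refine (heckePerm_eq_of_candidate hr ⟨-1, neg_one_mem_Gamma0 L⟩ i i.1 (-1) ?_).2
  simp only [Matrix.SpecialLinearGroup.coe_neg, Matrix.SpecialLinearGroup.coe_one, neg_mul, one_mul, mul_neg, mul_one]

/-- **`(T_r u)(−1) = (r + 1) · u(−1)`** for `r ∤ L`. [cite: Shimura1971, §8.3 (8.3.2)] -/
theorem heckeU_apply_neg_one (hrL : ¬ r ∣ L) (u : Gamma0 L → Fin 1 → K) :
    heckeU 0 L K hr u ⟨-1, neg_one_mem_Gamma0 L⟩ = (r + 1) • u ⟨-1, neg_one_mem_Gamma0 L⟩ := by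
  rw [heckeU_apply]
  simp only [act_zero_eq_id, LinearMap.id_apply]
  have h : ∀ i : HeckeIdx L r, heckePermElt hr ⟨-1, neg_one_mem_Gamma0 L⟩ i = ⟨-1, neg_one_mem_Gamma0 L⟩ :=
    fun i ↦ Subtype.ext (heckePermElt_neg_one L hr i)
  simp_rw [h]
  rw [Finset.sum_const, Finset.card_univ, card_heckeIdx_of_not_dvd L hrL]

end NegOne

/-! ### N4 PARABOLICITY -/

section Main

variable (L : ℕ) [NeZero L] {K : Type*} [Field K] [IsAlgClosed K]

/-- **N4 PARABOLICITY (step (0) of MEMO-es §22.2; `H¹`-twin of E-es-30).**  Over an algebraically closed field `K`, let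
`S ⊇` primes of `L`, `λ : ℕ → K` NOT a weight-`2` Eisenstein system, and `u ∈ Hom(Γ₀(L), K)` (`cocycles 0 L K`) a generalised
eigenvector of `T_r` (`heckeUZ 0 L K`) with eigenvalue `λ(r)` for every prime `r ∉ S`.  Then `u(γ) = 0` for every
`γ ∈ Γ₀(L)` fixing a point of `P¹(ℚ)` — `u` is PARABOLIC, i.e. it satisfies the hypothesis of
`exists_cuspSymbol_of_parabolic_hom`. [cite: DiamondShurman2005, Prop. 5.2.3 (p. 173)] -/
theorem parabolic_of_isHeckeGenEigenvector (S : Finset ℕ) (hS : ∀ q : ℕ, q.Prime → q ∣ L → q ∈ S) (lam : ℕ → K)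
    (u : cocycles 0 L K) (hgen : IsHeckeGenEigenvector S lam u) (hne : ¬ IsEisensteinEigensystem 2 lam)
    (γ : Gamma0 L) (c : OnePoint ℚ) (hγ : (mapGL ℚ (γ : SL(2, ℤ)) : GL (Fin 2) ℚ) • c = c) :
    (u : Gamma0 L → Fin 1 → K) γ = 0 := by
  classical
  have hu : (u : Gamma0 L → Fin 1 → K) ∈ cocycles 0 L K := u.2
  -- (2) `u(−1) = 0`
  have hneg : (u : Gamma0 L → Fin 1 → K) ⟨-1, neg_one_mem_Gamma0 L⟩ = 0 := by
    by_contra hne0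
    apply hne
    have hlam : ∀ (r : ℕ), r.Prime → r ∉ S → lam r = r + 1 := by
      intro r hr hrS
      haveI : NeZero r := ⟨hr.ne_zero⟩
      have hrL : ¬ r ∣ L := fun h ↦ hrS (hS r hr h)
      obtain ⟨k, hk⟩ := (isHeckeGenEigenvector_iff S lam u).mp hgen r hr hrS
      have hstep : ∀ v : cocycles 0 L K,
          (((heckeUZ 0 L K hr - lam r • (1 : Module.End K (cocycles 0 L K))) v : cocycles 0 L K) :
            Gamma0 L → Fin 1 → K) ⟨-1, neg_one_mem_Gamma0 L⟩ =
            ((r + 1 : K) - lam r) • (v : Gamma0 L → Fin 1 → K) ⟨-1, neg_one_mem_Gamma0 L⟩ := by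
        intro v
        rw [LinearMap.sub_apply, LinearMap.smul_apply, Module.End.one_apply, Submodule.coe_sub, Submodule.coe_smul,
          coe_heckeUZ, Pi.sub_apply, Pi.smul_apply, heckeU_apply_neg_one L hr hrL, ← Nat.cast_smul_eq_nsmul K (r + 1),
          Nat.cast_add, Nat.cast_one, sub_smul]
      have hpow : ∀ n : ℕ, ((((heckeUZ 0 L K hr - lam r • (1 : Module.End K (cocycles 0 L K))) ^ n) u : cocycles 0 L K) :
          Gamma0 L → Fin 1 → K) ⟨-1, neg_one_mem_Gamma0 L⟩ =
          (((r + 1 : K) - lam r) ^ n) • (u : Gamma0 L → Fin 1 → K) ⟨-1, neg_one_mem_Gamma0 L⟩ := by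
        intro n
        induction n with
        | zero => simp
        | succ n ih =>
          rw [pow_succ', Module.End.mul_apply, hstep, ih, smul_smul, ← pow_succ']
      have h0 := hpow k
      rw [hk, Submodule.coe_zero, Pi.zero_apply] at h0
      have hzero : ((r + 1 : K) - lam r) ^ k = 0 := by
        rcases smul_eq_zero.mp h0.symm with h | h
        · exact h
        · exact absurd h hne0
      have h1 := (pow_eq_zero_iff'.mp hzero).1
      rw [sub_eq_zero] at h1
      exact h1.symm
    refine ⟨S, 1, 1, 1, Nat.one_pos, fun ℓ hℓ hℓS ↦ ?_⟩
    rw [hlam ℓ hℓ hℓS, MulChar.one_apply (isUnit_of_subsingleton _)]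
    ring
  -- (1) `γ = ± g T^w g⁻¹`
  set g : SL(2, ℤ) := cuspMatrix c with hg
  have hγ' : (mapGL ℚ (γ : SL(2, ℤ)) : GL (Fin 2) ℚ) • (mapGL ℚ g : GL (Fin 2) ℚ) • (OnePoint.infty : OnePoint ℚ) =
      (mapGL ℚ g : GL (Fin 2) ℚ) • OnePoint.infty := by
    rw [hg, cuspMatrix_smul_infty, hγ]
  obtain ⟨w, hw⟩ := exists_eq_parabolicAt_of_smul_eq g γ hγ'
  -- (3) `u(g T^w g⁻¹) = 0`
  have hpar : ∀ hm : parabolicAt g w ∈ Gamma0 L, (u : Gamma0 L → Fin 1 → K) ⟨parabolicAt g w, hm⟩ = 0 := by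
    intro hm
    by_cases hw0 : w = 0
    · subst hw0
      have h1 : (⟨parabolicAt g 0, hm⟩ : Gamma0 L) = 1 := by
        apply Subtype.ext
        show parabolicAt g 0 = ((1 : Gamma0 L) : SL(2, ℤ))
        rw [parabolicAt_def, zpow_zero, mul_one, mul_inv_cancel, OneMemClass.coe_one]
      rw [h1, cocycle_map_one hu]
    · set S' : Finset ℕ := S ∪ w.natAbs.primeFactors with hS'
      have ha : parabolicValue L K w (u : Gamma0 L → Fin 1 → K) ∈ cuspInvariants L K :=
        parabolicValue_mem_cuspInvariants L w hu
      have heig : ∀ (r : ℕ) [NeZero r] (hr : r.Prime), r ∉ S' →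
          parabolicValue L K w (u : Gamma0 L → Fin 1 → K) ∈ Module.End.maxGenEigenspace
            ((r : K) • LinearMap.funLeft K K (heckeNbrInfty hr) + LinearMap.funLeft K K (heckeNbrZero hr)) (lam r) := by
        intro r _ hr hrS'
        have hrS : r ∉ S := fun h ↦ hrS' (Finset.mem_union_left _ h)
        have hrL : ¬ r ∣ L := fun h ↦ hrS (hS r hr h)
        have hrw : ¬ (r : ℤ) ∣ w := by
          intro h
          apply hrS'
          apply Finset.mem_union_right
          rw [Nat.mem_primeFactors]
          exact ⟨hr, Int.natCast_dvd.mp h, Int.natAbs_ne_zero.mpr hw0⟩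
        obtain ⟨k, hk⟩ := (isHeckeGenEigenvector_iff S lam u).mp hgen r hr hrS
        rw [Module.End.mem_maxGenEigenspace]
        refine ⟨k, ?_⟩
        set T : Module.End K (OnePoint ℚ → K) :=
          (r : K) • LinearMap.funLeft K K (heckeNbrInfty hr) + LinearMap.funLeft K K (heckeNbrZero hr) with hT
        have hcomm : ∀ (n : ℕ) (v : cocycles 0 L K),
            parabolicValue L K w ((((heckeUZ 0 L K hr - lam r • (1 : Module.End K (cocycles 0 L K))) ^ n) v :
              cocycles 0 L K) : Gamma0 L → Fin 1 → K) =
              ((T - lam r • 1) ^ n) (parabolicValue L K w (v : Gamma0 L → Fin 1 → K)) := by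
          intro n
          induction n with
          | zero => intro v; simp
          | succ n ih =>
            intro v
            rw [pow_succ, Module.End.mul_apply, ih, pow_succ, Module.End.mul_apply]
            congr 1
            rw [LinearMap.sub_apply, LinearMap.smul_apply, Module.End.one_apply, Submodule.coe_sub, Submodule.coe_smul,
              coe_heckeUZ, map_sub, map_smul, parabolicValue_heckeU L hr hrL w hrw v.2, hT, LinearMap.sub_apply,
              LinearMap.smul_apply, Module.End.one_apply]
        have h := hcomm k u
        rw [hk, Submodule.coe_zero, map_zero] at h
        exact h.symm
      have hzero := sharpEisenstein_cuspFun L S' (fun q hq hqL ↦ Finset.mem_union_left _ (hS q hq hqL)) lam _ ha heig hne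
      have hval := congrFun hzero c
      rw [Pi.zero_apply, parabolicValue_apply_of_mem L K w _ c hm] at hval
      funext i
      rw [Fin.fin_one_eq_zero i, hval, Pi.zero_apply]
  -- conclusion
  rcases hw with h | h
  · have hm : parabolicAt g w ∈ Gamma0 L := h ▸ γ.2
    have hγeq : γ = ⟨parabolicAt g w, hm⟩ := Subtype.ext h
    rw [hγeq]
    exact hpar hm
  · have hm : parabolicAt g w ∈ Gamma0 L := by
      have h1 : parabolicAt g w = (-1 : SL(2, ℤ)) * (γ : SL(2, ℤ)) := by rw [h, neg_mul, one_mul, neg_neg]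
      rw [h1]
      exact Subgroup.mul_mem _ (neg_one_mem_Gamma0 L) γ.2
    have hγeq : γ = (⟨-1, neg_one_mem_Gamma0 L⟩ : Gamma0 L) * ⟨parabolicAt g w, hm⟩ := by
      apply Subtype.ext
      rw [Subgroup.coe_mul, h, neg_mul, one_mul]
    rw [hγeq, cocycle_zero_mul hu, hneg, hpar hm, add_zero]

end Main

end Summit.BirchSwinnertonDyer.BirchSwinnertonDyer.Theorems.ManinLocalTwoThree

/-! ### Base change: the hypothesis over `K̄` (the form used by `RelativeIharaShiftVanishingBar`) -/

namespace Summit.BirchSwinnertonDyer.BirchSwinnertonDyer.Theorems.ManinLocalTwoThree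

section BaseChange

open Literature.NumberTheory.EllipticCurves.ModularForms.HidaCohomology

variable (L : ℕ) {K K' : Type*} [Field K] [Field K'] (f : K →+* K') {r : ℕ} [NeZero r] (hr : r.Prime)

/-- Post-composition of a degree-`0` cochain with a ring map (plumbing). [folklore] -/
theorem heckeU_zero_map (v : Gamma0 L → Fin 1 → K) :
    heckeU 0 L K' hr (fun γ i ↦ f (v γ i)) = fun γ i ↦ f (heckeU 0 L K hr v γ i) := by
  funext γ i
  rw [heckeU_apply, heckeU_apply, Finset.sum_apply, Finset.sum_apply, map_sum]
  simp only [act_zero_eq_id, LinearMap.id_apply]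

/-- A degree-`0` cocycle stays a cocycle after post-composition with a ring map. [folklore] -/
theorem cocycles_zero_map {v : Gamma0 L → Fin 1 → K} (hv : v ∈ cocycles 0 L K) :
    (fun γ i ↦ f (v γ i)) ∈ cocycles 0 L K' := by
  rw [mem_cocycles_iff] at hv ⊢
  intro γ δ
  funext i
  rw [act_zero_eq_id, LinearMap.id_apply, Pi.add_apply]
  have h := congrFun (hv γ δ) i
  rw [act_zero_eq_id, LinearMap.id_apply, Pi.add_apply] at h
  rw [h, map_add]

/-- **N4 PARABOLICITY with the non-Eisenstein hypothesis over a larger field** (e.g. `K̄ = AlgebraicClosure K`, the form of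
`RelativeIharaShiftVanishingBar`): for ANY field `K`, a generalised Hecke eigen-homomorphism `u ∈ Hom(Γ₀(L), K)` whose
system `λ` is not Eisenstein after an embedding `f : K → K'` into an algebraically closed field kills every cusp-fixing
element of `Γ₀(L)`.  (Base change `u ↦ f ∘ u` to `K'`, then `parabolic_of_isHeckeGenEigenvector`.) [cite: DiamondShurman2005, Prop. 5.2.3 (p. 173)] -/
theorem parabolic_of_isHeckeGenEigenvector_map [NeZero L] [IsAlgClosed K'] (S : Finset ℕ)
    (hS : ∀ q : ℕ, q.Prime → q ∣ L → q ∈ S) (lam : ℕ → K) (u : cocycles 0 L K) (hgen : IsHeckeGenEigenvector S lam u)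
    (hne : ¬ IsEisensteinEigensystem 2 (fun ℓ ↦ f (lam ℓ)))
    (γ : Gamma0 L) (c : OnePoint ℚ) (hγ : (mapGL ℚ (γ : SL(2, ℤ)) : GL (Fin 2) ℚ) • c = c) :
    (u : Gamma0 L → Fin 1 → K) γ = 0 := by
  let u' : cocycles 0 L K' := ⟨fun γ i ↦ f ((u : Gamma0 L → Fin 1 → K) γ i), cocycles_zero_map L f u.2⟩
  -- `(T_r − f λ)^k (f ∘ u) = f ∘ (T_r − λ)^k u`
  have hpow : ∀ (r : ℕ) [NeZero r] (hr : r.Prime) (k : ℕ) (v : cocycles 0 L K),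
      ((((heckeUZ 0 L K' hr - f (lam r) • (1 : Module.End K' (cocycles 0 L K'))) ^ k)
        ⟨fun γ i ↦ f ((v : Gamma0 L → Fin 1 → K) γ i), cocycles_zero_map L f v.2⟩ : cocycles 0 L K') :
          Gamma0 L → Fin 1 → K') =
        fun γ i ↦ f (((((heckeUZ 0 L K hr - lam r • (1 : Module.End K (cocycles 0 L K))) ^ k) v : cocycles 0 L K) :
          Gamma0 L → Fin 1 → K) γ i) := by
    intro r _ hr k
    induction k with
    | zero => intro v; rfl
    | succ k ih =>
      intro v
      rw [pow_succ', Module.End.mul_apply, pow_succ', Module.End.mul_apply]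
      -- name the inner cocycle over `K`
      set v₁ : cocycles 0 L K := ((heckeUZ 0 L K hr - lam r • (1 : Module.End K (cocycles 0 L K))) ^ k) v with hv₁
      have h1 : ((heckeUZ 0 L K' hr - f (lam r) • (1 : Module.End K' (cocycles 0 L K'))) ^ k)
          ⟨fun γ i ↦ f ((v : Gamma0 L → Fin 1 → K) γ i), cocycles_zero_map L f v.2⟩ =
          (⟨fun γ i ↦ f ((v₁ : Gamma0 L → Fin 1 → K) γ i), cocycles_zero_map L f v₁.2⟩ : cocycles 0 L K') :=
        Subtype.ext (ih v)
      rw [h1]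
      funext γ i
      simp only [LinearMap.sub_apply, LinearMap.smul_apply, Module.End.one_apply, Submodule.coe_sub, Submodule.coe_smul,
        coe_heckeUZ, Pi.sub_apply, Pi.smul_apply, smul_eq_mul, map_sub, map_mul]
      rw [heckeU_zero_map L f hr]
  have hgen' : IsHeckeGenEigenvector S (fun ℓ ↦ f (lam ℓ)) u' := by
    rw [isHeckeGenEigenvector_iff] at hgen ⊢
    intro r _ hr hrS
    obtain ⟨k, hk⟩ := hgen r hr hrS
    refine ⟨k, Subtype.ext ?_⟩
    rw [hpow r hr k u, hk]
    funext γ i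
    rw [Submodule.coe_zero, Pi.zero_apply, Pi.zero_apply, map_zero, Submodule.coe_zero, Pi.zero_apply, Pi.zero_apply]
  have h := parabolic_of_isHeckeGenEigenvector L S hS (fun ℓ ↦ f (lam ℓ)) u' hgen' hne γ c hγ
  funext i
  have hi := congrFun h i
  change f ((u : Gamma0 L → Fin 1 → K) γ i) = 0 at hi
  rw [Pi.zero_apply]
  exact (map_eq_zero f).mp hi

end BaseChange

end Summit.BirchSwinnertonDyer.BirchSwinnertonDyer.Theorems.ManinLocalTwoThree
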